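import Literature.NumberTheory.EllipticCurves.CongruentNumberEvenFiveThreeRankBound
import Literature.NumberTheory.EllipticCurves.TwoDescentKummerBridgeAdditivePlace
import Literature.NumberTheory.EllipticCurves.TwoDescentKummerBridgeRealPlace
import HarnessLib

/-!
# `#Sel⁽²⁾(E_{2pq}/ℚ) ≤ 8` for primes `p ≡ 5 (mod 8)`, `q ≡ 3 (mod 4)`, `(p/q) = −1`, by complete `2`-descent

Topic `NumberTheory/EllipticCurves`; namespace
`Literature.NumberTheory.EllipticCurves.CongruentNumberTwicePrimePairSelmer`. The `2`-SELMER
companion of the rank bound `rk E_{2pq}(ℚ) ≤ 1` of `CongruentNumberEvenFiveThreeRankBound.lean`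
(Lagrange 1975 §11 / Silverman AEC Prop. X.1.4 on RATIONAL points): the same four linear conditions,
now imposed on SELMER classes through the cell's descent–Selmer bridge — `Sel⁽²⁾(E/ℚ) ⊆ ℚ(S,2)²`
with even valuation off `S` (`TwoDescentKummerBridgeRat.lean`), the `I₀*` relations at `p` and `q`
on `ℚ_p`- and `ℚ_q`-points (`TwoDescentKummerBridgeAdditivePlace.lean`), positivity at the real place
(`TwoDescentKummerBridgeRealPlace.lean`) and the injection
`(H¹(χ₁), H¹(χ₂)) : H¹(ℚ, E[2]) ↪ (ℚˣ/ℚˣ²)²` (`TwoDescentTwoTorsionCharacter.lean`).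

For `E = E_{2pq} : y² = x³ − (2pq)²x = (x + 2pq)·x·(x − 2pq)` (`e₁ = −2pq < e₂ = 0 < e₃ = 2pq`;
`S = {2, p, q}`, both odd primes of type `I₀*`), a class `c ∈ Sel⁽²⁾(E/ℚ)` has components
`(a, b) = (x + 2pq, x)` with `a ∈ ⟨2, p, q⟩`, `b ∈ ⟨−1, 2, p, q⟩` modulo squares — seven `𝔽₂`-coordinates
`(v₂ a, v_p a, v_q a; sign b, v₂ b, v_p b, v_q b)` (injective on `Sel⁽²⁾`) — subject,
when `(p/q) = −1` (so `(q/p) = −1`, `(2/p) = −1`, `(−1/p) = 1`, `(−1/q) = −1`; `u = [(2/q) = −1]`), to the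
four independent relations
`v₂ a + v_q a = v_p b`, `v₂ b + v_q b = 0` (the place `p`),
`u·v₂ a + v_p a = (1+u)·v_q a + u·v_q b`, `sign b + u·v₂ b + v_p b = v_q a + u·v_q b` (the place `q`);
hence `#Sel⁽²⁾(E_{2pq}/ℚ) ≤ 2^{7−4} = 8` (`card_selmerGroup_two_le_eight`). NO condition at the place `2`
is used: on this half-family the places `p`, `q`, `∞` and the good primes already cut the `2⁷`
sign-normalised candidate pairs down to `2³` (on the half `(p/q) = +1` they do not, cf. the
`2`-adic row of `CongruentNumberEvenFiveThreeRankBound.kill_53`).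

A pure proof file (no definitions: the `T₁`/`T₂`-components are written `kummerEquiv ℚ 2 (twoTorsionCharH1 h c)`
as in `TwoDescentKummerBridgeRat.lean`, the seven coordinates as an explicit vector). This is the hypothesis `hD` / `hSel` (`#Sel₂(E_{2pq}) ≤ 8` on `𝒮⁻`) of the cell `bsd-monsky`'s
enclosure (`P2/CongruentNumberSilentEvenFiveEnclosureSelmerBound.lean`,
`P2/CongruentNumberSilentEvenFiveThetaCMClassFieldSelmer.lean`), there displayed as Aoki 1999
Thm. 2.2 / Monsky's appendix to Heath-Brown 1994 / Monsky 1990 Cor. 5.15 (`#Sel₂ = 8`); here it is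
PROVED, unconditionally, by the complete `2`-descent. Everything is proved; no named facts.

## References

* [SilvermanAEC2009] J. H. Silverman, *The Arithmetic of Elliptic Curves*, 2nd ed., GTM 106,
  Springer 2009, Prop. X.1.4, Prop. X.4.9, Example X.4.10.
* [Lagrange1975] J. Lagrange, *Nombres congruents et courbes elliptiques*, Sém. Delange–Pisot–Poitou
  16 (1974/75), exp. 16, §11 (table p. 16-12: `n = 2pq`, `p ≡ −3 (8)`).
* [Monsky1990MockHeegner] P. Monsky, *Mock Heegner points and congruent numbers*, Math. Z. 204
  (1990) 45–68, Cor. 5.15 (2′) (`#Sel₂ = 8` printed for these `N`).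
-/

noncomputable section

open scoped Classical

-- opened at top level: inside `namespace Literature.NumberTheory.EllipticCurves` the name `WeierstrassCurve`
-- is shadowed by `Literature.NumberTheory.EllipticCurves.WeierstrassCurve.*` declarations of the import closure
open WeierstrassCurve WeierstrassCurve.Affine WeierstrassCurve.Affine.Point
open Literature.NumberTheory.GaloisRepresentations
open Literature.NumberTheory.EllipticCurves.KramerTwoDescent
open Literature.NumberTheory.EllipticCurves.TwoDescentLocal
open IsDedekindDomain NumberField Rat.HeightOneSpectrum
open Literature.Barriers.BirchSwinnertonDyer.DokchitserDokchitser2011 (padicValRat_eq_of_eq)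

namespace Literature.NumberTheory.EllipticCurves

namespace CongruentNumberTwicePrimePairSelmer

variable {p q : ℕ} [hp : Fact p.Prime] [hq : Fact q.Prime]

/-- `2pq ≠ 0`. [folklore] -/
private theorem two_mul_ne_zero : 2 * (p * q) ≠ 0 :=
  mul_ne_zero two_ne_zero (mul_ne_zero hp.out.ne_zero hq.out.ne_zero)

/-! ## Small arithmetic helpers (as in `CongruentNumberEvenFiveThreeRankBound.lean`, where they are private) -/

omit hq in
/-- `p ∤ 1`. [folklore] -/
private theorem p_ndvd_one : ¬ p ∣ 1 := fun h => hp.out.ne_one (Nat.dvd_one.mp h)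

/-- `p ∤ 2ᵏ qʲ` for distinct primes `p ≠ 2`, `p ≠ q`. [folklore] -/
private theorem p_ndvd (hp2 : p ≠ 2) (hpq : p ≠ q) (k j : ℕ) : ¬ p ∣ 2 ^ k * q ^ j := fun h => by
  rcases (Nat.Prime.dvd_mul hp.out).mp h with h | h
  · exact hp2 ((Nat.prime_dvd_prime_iff_eq hp.out Nat.prime_two).mp (hp.out.dvd_of_dvd_pow h))
  · exact hpq ((Nat.prime_dvd_prime_iff_eq hp.out hq.out).mp (hp.out.dvd_of_dvd_pow h))

/-- `(q : ℤ)` and `p` are coprime for distinct primes. [folklore] -/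
private theorem gcd_q_p (hpq : p ≠ q) : (q : ℤ).gcd p = 1 := by
  rw [Int.gcd_natCast_natCast]; exact (Nat.coprime_primes hq.out hp.out).mpr (Ne.symm hpq)

omit hq in
/-- `(2 : ℤ)` and an odd prime `p` are coprime. [folklore] -/
private theorem gcd_two_p (hp2 : p ≠ 2) : (2 : ℤ).gcd p = 1 := by
  rw [show (2 : ℤ) = ((2 : ℕ) : ℤ) from rfl, Int.gcd_natCast_natCast]
  exact (Nat.coprime_primes Nat.prime_two hp.out).mpr (Ne.symm hp2)

omit hp hq in
/-- `(2/p) = −1` for `p ≡ 5 (mod 8)`. [folklore] -/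
private theorem jac_two_of_five (h8 : p % 8 = 5) : jacobiSym 2 p = -1 := by
  rw [jacobiSym.at_two (Nat.odd_iff.mpr (by omega)), ZMod.χ₈_nat_eq_if_mod_eight]
  have h2 : p % 2 ≠ 0 := by omega
  have h17 : ¬ (p % 8 = 1 ∨ p % 8 = 7) := by omega
  simp only [h2, if_false, h17]

omit hp hq in
/-- `(−1/p) = 1` for `p ≡ 5 (mod 8)`. [folklore] -/
private theorem jac_neg_one_of_five (h8 : p % 8 = 5) : jacobiSym (-1) p = 1 := by
  rw [jacobiSym.at_neg_one (Nat.odd_iff.mpr (by omega)), ZMod.χ₄_nat_eq_if_mod_four]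
  have h2 : p % 2 ≠ 0 := by omega
  have h41 : p % 4 = 1 := by omega
  simp only [h2, if_false, h41, if_true]

omit hp hq in
/-- `(−1/q) = −1` for `q ≡ 3 (mod 4)`. [folklore] -/
private theorem jac_neg_one_of_three_mod_four (h4 : p % 4 = 3) : jacobiSym (-1) p = -1 := by
  rw [jacobiSym.at_neg_one (Nat.odd_iff.mpr (by omega)), ZMod.χ₄_nat_eq_if_mod_four]
  have h2 : p % 2 ≠ 0 := by omega
  have h41 : p % 4 ≠ 1 := by omega
  simp only [h2, if_false, h41]

/-- The class of a unit `a ∈ ℚˣ` in `ℚˣ/ℚˣ²` is `sqClass a`. [cite: SilvermanAEC2009, Prop. X.1.4] -/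
theorem mk_eq_sqClass (a : ℚˣ) : (QuotientGroup.mk a : SqUnits ℚ) = sqClass (a : ℚ) := by
  rw [sqClass_of_ne_zero a.ne_zero]
  congr 1
  ext
  rw [Units.val_mk0]

/-! ## The local conditions on a Selmer class, in coordinates
The components of a class `c ∈ H¹(ℚ, E_{2pq}[2])` are written `kummerEquiv ℚ 2 (twoTorsionCharH1 hT c)` (`T₁`) and
`kummerEquiv ℚ 2 (twoTorsionCharH1 hT.swap₁₂ c)` (`T₂`) for the rational `2`-torsion
`hT : SplitTwoTorsion (−2pq) 0 (2pq)` (`splitTwoTorsion_cn`), with representatives `a, b ∈ ℚˣ`. -/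

variable [hE : (congruentNumberCurve (2 * (p * q))).IsElliptic]
variable (hT : (congruentNumberCurve (2 * (p * q))).toAffine.SplitTwoTorsion (-((2 * (p * q) : ℕ) : ℚ)) 0
  ((2 * (p * q) : ℕ) : ℚ))

/-- **Parity off `S = {2, p, q}`**: both components of a Selmer class of `E_{2pq}` have even valuation
at every prime `r ∉ {2, p, q}`. [cite: SilvermanAEC2009, Prop. X.1.4, Prop. X.4.9] -/
theorem even_padicValRat_of_mem (hp2 : p ≠ 2) (hq2 : q ≠ 2) (hpq : p ≠ q)
    {c : galH1Torsion (congruentNumberCurve (2 * (p * q))) 2}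
    (hc : c ∈ (congruentNumberCurve (2 * (p * q))).selmerGroup 2) (a b : ℚˣ)
    (ha : kummerEquiv ℚ 2 ((congruentNumberCurve (2 * (p * q))).twoTorsionCharH1 hT c) =
      Additive.ofMul (QuotientGroup.mk a))
    (hb : kummerEquiv ℚ 2 ((congruentNumberCurve (2 * (p * q))).twoTorsionCharH1 hT.swap₁₂ c) =
      Additive.ofMul (QuotientGroup.mk b))
    {r : ℕ} (hr : r.Prime) (hr2 : r ≠ 2) (hrp : r ≠ p) (hrq : r ≠ q) :
    haveI : Fact r.Prime := ⟨hr⟩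
    Even (padicValRat r (a : ℚ)) ∧ Even (padicValRat r (b : ℚ)) := by
  haveI : Fact r.Prime := ⟨hr⟩
  set W := congruentNumberCurve (2 * (p * q)) with hW
  set v : HeightOneSpectrum (𝓞 ℚ) := primesEquiv.symm ⟨r, hr⟩ with hv
  have hrv : (primesEquiv v : ℕ) = r := by rw [hv, Equiv.apply_symm_apply]
  have hl2pq : ∀ x ∈ ([2, p, q] : List ℕ), x.Prime := by
    intro x hx
    simp only [List.mem_cons, List.not_mem_nil, or_false] at hx
    rcases hx with rfl | rfl | rfl
    exacts [Nat.prime_two, hp.out, hq.out]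
  have hl22pq : ∀ x ∈ ([2, 2, p, q] : List ℕ), x.Prime := by
    intro x hx
    simp only [List.mem_cons, List.not_mem_nil, or_false] at hx
    rcases hx with rfl | rfl | rfl | rfl
    exacts [Nat.prime_two, Nat.prime_two, hp.out, hq.out]
  have hrl : r ∉ ([2, p, q] : List ℕ) := by
    simp only [List.mem_cons, List.not_mem_nil, or_false, not_or]; exact ⟨hr2, hrp, hrq⟩
  have hrl' : r ∉ ([2, 2, p, q] : List ℕ) := by
    simp only [List.mem_cons, List.not_mem_nil, or_false, not_or]; exact ⟨hr2, hr2, hrp, hrq⟩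
  -- the four valuations `v_r(eᵢ − eⱼ) = 0`
  have e12 : padicValRat r (-((2 * (p * q) : ℕ) : ℚ) - 0) = 0 := by
    rw [show (-((2 * (p * q) : ℕ) : ℚ)) - 0 = ((-(2 * p * q : ℤ) : ℤ) : ℚ) by push_cast; ring]
    exact padicValRat_eq_zero_of_eq_prod hr [2, p, q] hl2pq hrl (by simp [Int.natAbs_mul, Int.natAbs_neg]; ring)
  have e13 : padicValRat r (-((2 * (p * q) : ℕ) : ℚ) - ((2 * (p * q) : ℕ) : ℚ)) = 0 := by
    rw [show (-((2 * (p * q) : ℕ) : ℚ)) - ((2 * (p * q) : ℕ) : ℚ) = ((-(2 * 2 * p * q : ℤ) : ℤ) : ℚ) by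
      push_cast; ring]
    exact padicValRat_eq_zero_of_eq_prod hr [2, 2, p, q] hl22pq hrl'
      (by simp [Int.natAbs_mul, Int.natAbs_neg]; ring)
  have e21 : padicValRat r ((0 : ℚ) - -((2 * (p * q) : ℕ) : ℚ)) = 0 := by
    rw [show (0 : ℚ) - -((2 * (p * q) : ℕ) : ℚ) = (((2 * p * q : ℤ)) : ℚ) by push_cast; ring]
    exact padicValRat_eq_zero_of_eq_prod hr [2, p, q] hl2pq hrl (by simp [Int.natAbs_mul]; ring)
  have e23 : padicValRat r ((0 : ℚ) - ((2 * (p * q) : ℕ) : ℚ)) = 0 := by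
    rw [show (0 : ℚ) - ((2 * (p * q) : ℕ) : ℚ) = ((-(2 * p * q : ℤ) : ℤ) : ℚ) by push_cast; ring]
    exact padicValRat_eq_zero_of_eq_prod hr [2, p, q] hl2pq hrl (by simp [Int.natAbs_mul, Int.natAbs_neg]; ring)
  constructor
  · have := W.even_padicValRat_of_mem_selmerGroup hT hc v (by rw [hrv]; exact e12) (by rw [hrv]; exact e13) a ha
    rwa [hrv] at this
  · have := W.even_padicValRat_of_mem_selmerGroup hT.swap₁₂ hc v (by rw [hrv]; exact e21)
      (by rw [hrv]; exact e23) b hb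
    rwa [hrv] at this

/-- **The real place**: the first component of a Selmer class of `E_{2pq}` is positive
(`e₁ = −2pq` is the smallest root). [cite: SilvermanAEC2009, Prop. X.1.4, Prop. X.4.9] -/
theorem pos_of_mem {c : galH1Torsion (congruentNumberCurve (2 * (p * q))) 2}
    (hc : c ∈ (congruentNumberCurve (2 * (p * q))).selmerGroup 2) (a : ℚˣ)
    (ha : kummerEquiv ℚ 2 ((congruentNumberCurve (2 * (p * q))).twoTorsionCharH1 hT c) =
      Additive.ofMul (QuotientGroup.mk a)) : 0 < (a : ℚ) := by
  have hn : 2 * (p * q) ≠ 0 := two_mul_ne_zero (p := p) (q := q)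
  have hN : (0 : ℚ) < ((2 * (p * q) : ℕ) : ℚ) := by exact_mod_cast Nat.pos_of_ne_zero hn
  exact (congruentNumberCurve (2 * (p * q))).pos_of_mem_selmerGroup_of_lt hT (by linarith) (by linarith) hc a ha

/-- **The `I₀*` relations at `p` and at `q`** for a Selmer class of `E_{2pq}` (`p, q` odd, distinct), raw
form: the two relations of `qrBit_eq_of_mem_selmerGroup_of_add` at the place over `ℓ ∈ {p, q}` with the
constants `e₂ − e₁ = 2pq`, `(e₁ − e₂)(e₁ − e₃) = 8p²q²`, `(e₂ − e₁)(e₂ − e₃) = −4p²q²`, `e₁ − e₂ = −2pq`.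
[cite: SilvermanAEC2009, Prop. X.1.4, Prop. X.4.9] -/
theorem qrBit_rel_of_mem {ℓ : ℕ} (hℓ : ℓ.Prime) (hℓpq : ℓ = p ∨ ℓ = q) (hp2 : p ≠ 2)
    (hq2 : q ≠ 2) (hpq : p ≠ q) {c : galH1Torsion (congruentNumberCurve (2 * (p * q))) 2}
    (hc : c ∈ (congruentNumberCurve (2 * (p * q))).selmerGroup 2) (a b : ℚˣ)
    (ha : kummerEquiv ℚ 2 ((congruentNumberCurve (2 * (p * q))).twoTorsionCharH1 hT c) =
      Additive.ofMul (QuotientGroup.mk a))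
    (hb : kummerEquiv ℚ 2 ((congruentNumberCurve (2 * (p * q))).twoTorsionCharH1 hT.swap₁₂ c) =
      Additive.ofMul (QuotientGroup.mk b)) :
    haveI : Fact ℓ.Prime := ⟨hℓ⟩
    qrBit ℓ (a : ℚ) = parityBit ℓ (a : ℚ) * qrBit ℓ ((0 : ℚ) - -((2 * (p * q) : ℕ) : ℚ)) +
        parityBit ℓ (b : ℚ) * qrBit ℓ ((-((2 * (p * q) : ℕ) : ℚ) - 0) * (-((2 * (p * q) : ℕ) : ℚ) -
          ((2 * (p * q) : ℕ) : ℚ))) ∧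
      qrBit ℓ (b : ℚ) = parityBit ℓ (a : ℚ) * qrBit ℓ (((0 : ℚ) - -((2 * (p * q) : ℕ) : ℚ)) *
          ((0 : ℚ) - ((2 * (p * q) : ℕ) : ℚ))) + parityBit ℓ (b : ℚ) * qrBit ℓ (-((2 * (p * q) : ℕ) : ℚ) - 0) := by
  haveI : Fact ℓ.Prime := ⟨hℓ⟩
  set W := congruentNumberCurve (2 * (p * q)) with hW
  set v : HeightOneSpectrum (𝓞 ℚ) := primesEquiv.symm ⟨ℓ, hℓ⟩ with hv
  have hℓv : (primesEquiv v : ℕ) = ℓ := by rw [hv, Equiv.apply_symm_apply]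
  -- the three valuations `v_ℓ(eᵢ − eⱼ) = 1`, `ℓ ∈ {p, q}`
  have hval : ∀ k : ℕ, padicValRat ℓ (((2 : ℚ) ^ k) * ((p : ℚ) * q)) = 1 := by
    intro k
    rcases hℓpq with h | h
    · rw [h]
      exact padicValRat_eq_of_eq (p := p) 1 (u := 2 ^ k * q ^ 1) (v := 1) 1 (Or.inl rfl)
        (p_ndvd hp2 hpq k 1) p_ndvd_one (by push_cast; ring)
    · rw [h]
      exact padicValRat_eq_of_eq (p := q) 1 (u := 2 ^ k * p ^ 1) (v := 1) 1 (Or.inl rfl)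
        (p_ndvd (p := q) (q := p) hq2 (Ne.symm hpq) k 1) (p_ndvd_one (p := q)) (by push_cast; ring)
  have h12 : padicValRat ℓ (-((2 * (p * q) : ℕ) : ℚ) - 0) = 1 := by
    rw [show -((2 * (p * q) : ℕ) : ℚ) - 0 = -((2 : ℚ) ^ 1 * ((p : ℚ) * q)) by push_cast; ring,
      padicValRat.neg]
    exact hval 1
  have h13 : padicValRat ℓ (-((2 * (p * q) : ℕ) : ℚ) - ((2 * (p * q) : ℕ) : ℚ)) = 1 := by
    rw [show -((2 * (p * q) : ℕ) : ℚ) - ((2 * (p * q) : ℕ) : ℚ) = -((2 : ℚ) ^ 2 * ((p : ℚ) * q)) by push_cast; ring,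
      padicValRat.neg]
    exact hval 2
  have h23 : padicValRat ℓ ((0 : ℚ) - ((2 * (p * q) : ℕ) : ℚ)) = 1 := by
    rw [show (0 : ℚ) - ((2 * (p * q) : ℕ) : ℚ) = -((2 : ℚ) ^ 1 * ((p : ℚ) * q)) by push_cast; ring,
      padicValRat.neg]
    exact hval 1
  have key := W.qrBit_eq_of_mem_selmerGroup_of_add hT hc v (by rw [hℓv]; exact h12) (by rw [hℓv]; exact h13)
    (by rw [hℓv]; exact h23) a b ha hb
  simp only [hℓv] at key
  exact key

/-! ## The four linear relations (`u = [(2/q) = −1]`) -/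

set_option synthInstance.maxSize 100000 in
set_option synthInstance.maxHeartbeats 400000 in
/-- **The four relations annihilate the coordinates**: if `(a₂, a_p, a_q; s, b₂, b_p, b_q)` satisfy
`a₂ + a_q = b_p`, `b₂ + b_q = 0`, `a₂ u + a_p = a_q (u + 1) + b_q u`, `s + b₂ u + b_p = a_q + b_q u`, then
the `4 × 7` matrix of these relations kills the vector. [folklore] -/
private theorem rows (u a2 ap aq s b2 bp bq : ZMod 2) (P1 : a2 + aq = bp) (P2 : b2 + bq = 0)
    (Q1 : a2 * u + ap = aq * (u + 1) + bq * u) (Q2 : s + (b2 * u + bp) = aq + bq * u) :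
    (Matrix.mulVecLin (!![1, 0, 1, 0, 0, 1, 0; 0, 0, 0, 0, 1, 0, 1; u, 1, 1 + u, 0, 0, 0, u;
      0, 0, 1, 1, u, 1, u] : Matrix (Fin 4) (Fin 7) (ZMod 2))).toAddMonoidHom ![a2, ap, aq, s, b2, bp, bq] = 0 := by
  revert P1 P2 Q1 Q2 u a2 ap aq s b2 bp bq
  decide

/-- An explicit preimage: the matrix of the four relations is onto `(ℤ/2)⁴`. [folklore] -/
private theorem κ_apply_pivot : ∀ (u : ZMod 2) (w : Fin 4 → ZMod 2),
    (Matrix.mulVecLin (!![1, 0, 1, 0, 0, 1, 0; 0, 0, 0, 0, 1, 0, 1; u, 1, 1 + u, 0, 0, 0, u;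
      0, 0, 1, 1, u, 1, u] : Matrix (Fin 4) (Fin 7) (ZMod 2))).toAddMonoidHom
        ![0, w 2, 0, w 3 + w 0 + u * w 1, w 1, w 0, 0] = w := by
  decide

omit hp hq in
/-- The matrix of the four relations is surjective. [folklore] -/
private theorem κ_surjective (u : ZMod 2) : Function.Surjective
    (Matrix.mulVecLin (!![1, 0, 1, 0, 0, 1, 0; 0, 0, 0, 0, 1, 0, 1; u, 1, 1 + u, 0, 0, 0, u;
      0, 0, 1, 1, u, 1, u] : Matrix (Fin 4) (Fin 7) (ZMod 2))).toAddMonoidHom := fun w =>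
  ⟨![0, w 2, 0, w 3 + w 0 + u * w 1, w 1, w 0, 0], κ_apply_pivot u w⟩

/-! ## The descent on Selmer classes -/

/-- **The four relations hold on `Sel⁽²⁾(E_{2pq}/ℚ)`** for `p ≡ 5 (mod 8)`, `q ≡ 3 (mod 4)`,
`(p/q) = −1`, with `u = qrBit q 2 = [(2/q) = −1]`. [cite: SilvermanAEC2009, Prop. X.1.4, Prop. X.4.9] -/
theorem kill_selmer (h8p : p % 8 = 5) (h4q : q % 4 = 3) (hsym : jacobiSym p q = -1)
    {c : galH1Torsion (congruentNumberCurve (2 * (p * q))) 2}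
    (hc : c ∈ (congruentNumberCurve (2 * (p * q))).selmerGroup 2) (a b : ℚˣ)
    (ha : kummerEquiv ℚ 2 ((congruentNumberCurve (2 * (p * q))).twoTorsionCharH1 hT c) =
      Additive.ofMul (QuotientGroup.mk a))
    (hb : kummerEquiv ℚ 2 ((congruentNumberCurve (2 * (p * q))).twoTorsionCharH1 hT.swap₁₂ c) =
      Additive.ofMul (QuotientGroup.mk b))
    (u : ZMod 2) (hu : u = qrBit q ((2 : ℕ) : ℚ)) :
    (Matrix.mulVecLin (!![1, 0, 1, 0, 0, 1, 0; 0, 0, 0, 0, 1, 0, 1; u, 1, 1 + u, 0, 0, 0, u;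
      0, 0, 1, 1, u, 1, u] : Matrix (Fin 4) (Fin 7) (ZMod 2))).toAddMonoidHom
      ![parityBit 2 (a : ℚ), parityBit p (a : ℚ), parityBit q (a : ℚ), signBit (b : ℚ), parityBit 2 (b : ℚ),
        parityBit p (b : ℚ), parityBit q (b : ℚ)] = 0 := by
  have hp2 : p ≠ 2 := by rintro rfl; norm_num at h8p
  have hq2 : q ≠ 2 := by rintro rfl; norm_num at h4q
  have hpq : p ≠ q := by rintro rfl; omega
  have hqp : q ≠ p := Ne.symm hpq
  have hpr : p.Prime := hp.out
  have hqr : q.Prime := hq.out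
  have hp0 : (p : ℚ) ≠ 0 := Nat.cast_ne_zero.mpr hpr.ne_zero
  have hq0 : (q : ℚ) ≠ 0 := Nat.cast_ne_zero.mpr hqr.ne_zero
  have ha0 : (a : ℚ) ≠ 0 := a.ne_zero
  have hb0 : (b : ℚ) ≠ 0 := b.ne_zero
  -- the symbols: `(2/p) = −1`, `(−1/p) = 1`, `(−1/q) = −1`, `(q/p) = (p/q) = −1`
  have jP2 := jac_two_of_five (p := p) h8p
  have jPm1 := jac_neg_one_of_five (p := p) h8p
  have jQm1 := jac_neg_one_of_three_mod_four (p := q) h4q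
  have gqp := gcd_q_p (p := p) (q := q) hpq
  have gpq := gcd_q_p (p := q) (q := p) hqp
  have jP4 : jacobiSym ((2 : ℤ) ^ 2) p = 1 := jacobiSym.sq_one' (gcd_two_p (p := p) hp2)
  have jQ4 : jacobiSym ((2 : ℤ) ^ 2) q = 1 := jacobiSym.sq_one' (gcd_two_p (p := q) hq2)
  have jPqq : jacobiSym ((q : ℤ) ^ 2) p = 1 := jacobiSym.sq_one' gqp
  have jQpp : jacobiSym ((p : ℤ) ^ 2) q = 1 := jacobiSym.sq_one' gpq
  have hQR : jacobiSym (p : ℤ) q = jacobiSym (q : ℤ) p :=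
    jacobiSym.quadratic_reciprocity_one_mod_four (by omega) (Nat.odd_iff.mpr (by omega))
  have jPq : jacobiSym (q : ℤ) p = -1 := hQR ▸ hsym
  -- values of `qrBit` on the symbols
  have cPm1 : qrBit p ((-1 : ℚ)) = 0 := qrBit_eq_zero_of_eq (p := p) 0 (-1) (by norm_num) jPm1
  have cP2 : qrBit p (((2 : ℕ) : ℚ)) = 1 := qrBit_eq_one_of_eq (p := p) 0 (2) (by norm_num) jP2
  have cPq : qrBit p ((q : ℕ) : ℚ) = 1 := qrBit_eq_one_of_eq (p := p) 0 (q) (by norm_num) jPq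
  have cQm1 : qrBit q ((-1 : ℚ)) = 1 := qrBit_eq_one_of_eq (p := q) 0 (-1) (by norm_num) jQm1
  have cQp : qrBit q ((p : ℕ) : ℚ) = 1 := qrBit_eq_one_of_eq (p := q) 0 (p) (by norm_num) hsym
  have cQ2r : qrBit q (2 : ℚ) = qrBit q ((2 : ℕ) : ℚ) := by norm_cast
  -- the constants at `p`
  have kP0 : qrBit p ((-((2 * (p * q) : ℕ) : ℚ) - 0) * (-((2 * (p * q) : ℕ) : ℚ) - ((2 * (p * q) : ℕ) : ℚ))) = 1 :=
    qrBit_eq_one_of_eq (p := p) 2 (2 * 2 ^ 2 * q ^ 2) (by push_cast; ring)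
      (by rw [jacobiSym.mul_left, jacobiSym.mul_left, jP2, jP4, jPqq]; norm_num)
  have kP1 : qrBit p (-((2 * (p * q) : ℕ) : ℚ) - 0) = 0 :=
    qrBit_eq_zero_of_eq (p := p) 1 (-1 * 2 * q) (by push_cast; ring)
      (by rw [jacobiSym.mul_left, jacobiSym.mul_left, jPm1, jP2, jPq]; norm_num)
  have kP2 : qrBit p ((0 : ℚ) - -((2 * (p * q) : ℕ) : ℚ)) = 0 :=
    qrBit_eq_zero_of_eq (p := p) 1 (2 * q) (by push_cast; ring)
      (by rw [jacobiSym.mul_left, jP2, jPq]; norm_num)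
  have kP3 : qrBit p (((0 : ℚ) - -((2 * (p * q) : ℕ) : ℚ)) * (0 - ((2 * (p * q) : ℕ) : ℚ))) = 0 :=
    qrBit_eq_zero_of_eq (p := p) 2 (-1 * 2 ^ 2 * q ^ 2) (by push_cast; ring)
      (by rw [jacobiSym.mul_left, jacobiSym.mul_left, jPm1, jP4, jPqq]; norm_num)
  -- the constants at `q` (`u = qrBit q 2` symbolic)
  have k4p : qrBit q (4 * (p : ℚ) ^ 2) = 0 :=
    qrBit_eq_zero_of_eq (p := q) 0 (2 ^ 2 * p ^ 2) (by push_cast; ring)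
      (by rw [jacobiSym.mul_left, jQ4, jQpp]; norm_num)
  have kQ0 : qrBit q ((-((2 * (p * q) : ℕ) : ℚ) - 0) * (-((2 * (p * q) : ℕ) : ℚ) - ((2 * (p * q) : ℕ) : ℚ))) =
      qrBit q ((2 : ℕ) : ℚ) := by
    rw [show (-((2 * (p * q) : ℕ) : ℚ) - 0) * (-((2 * (p * q) : ℕ) : ℚ) - ((2 * (p * q) : ℕ) : ℚ)) =
        (q : ℚ) * ((q : ℚ) * ((2 : ℚ) * (4 * (p : ℚ) ^ 2))) by push_cast; ring, qrBit_natCast_mul,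
      qrBit_natCast_mul, qrBit_mul q (by norm_num) (by positivity), k4p, add_zero, cQ2r]
  have kQ1 : qrBit q (-((2 * (p * q) : ℕ) : ℚ) - 0) = qrBit q ((2 : ℕ) : ℚ) := by
    rw [show -((2 * (p * q) : ℕ) : ℚ) - 0 = (q : ℚ) * ((-1 : ℚ) * 2 * p) by push_cast; ring, qrBit_natCast_mul,
      qrBit_mul q (by norm_num) hp0, qrBit_mul q (by norm_num) (by norm_num), cQm1, cQ2r, cQp]
    generalize qrBit q ((2 : ℕ) : ℚ) = t; revert t; decide
  have kQ2 : qrBit q ((0 : ℚ) - -((2 * (p * q) : ℕ) : ℚ)) = qrBit q ((2 : ℕ) : ℚ) + 1 := by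
    rw [show (0 : ℚ) - -((2 * (p * q) : ℕ) : ℚ) = (q : ℚ) * ((2 : ℚ) * p) by push_cast; ring, qrBit_natCast_mul,
      qrBit_mul q (by norm_num) hp0, cQ2r, cQp]
  have kQ3 : qrBit q (((0 : ℚ) - -((2 * (p * q) : ℕ) : ℚ)) * (0 - ((2 * (p * q) : ℕ) : ℚ))) = 1 :=
    qrBit_eq_one_of_eq (p := q) 2 (-1 * 2 ^ 2 * p ^ 2) (by push_cast; ring)
      (by rw [jacobiSym.mul_left, jacobiSym.mul_left, jQm1, jQ4, jQpp]; norm_num)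
  -- the local conditions
  have hpos := pos_of_mem (p := p) (q := q) hT hc a ha
  have hsa : signBit (a : ℚ) = 0 := (signBit_eq_zero_iff ha0).mpr hpos
  have hev : ∀ r : ℕ, r.Prime → r ≠ 2 → r ≠ p → r ≠ q →
      Even (padicValRat r (a : ℚ)) ∧ Even (padicValRat r (b : ℚ)) := fun r hr hr2 hrp hrq =>
    even_padicValRat_of_mem (p := p) (q := q) hT hp2 hq2 hpq hc a b ha hb hr hr2 hrp hrq
  have HP := qrBit_rel_of_mem (p := p) (q := q) hT hpr (Or.inl rfl) hp2 hq2 hpq hc a b ha hb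
  have HQ := qrBit_rel_of_mem (p := p) (q := q) hT hqr (Or.inr rfl) hp2 hq2 hpq hc a b ha hb
  rw [kP0, kP1, kP2, kP3] at HP
  rw [kQ0, kQ1, kQ2, kQ3] at HQ
  -- square-free kernel expansions of `qrBit p a`, `qrBit p b`, `qrBit q a`, `qrBit q b`
  have hl2q : ∀ x ∈ ([2, q] : List ℕ), x.Prime := by
    intro x hx
    simp only [List.mem_cons, List.not_mem_nil, or_false] at hx
    rcases hx with rfl | rfl
    exacts [Nat.prime_two, hqr]
  have hl2p : ∀ x ∈ ([2, p] : List ℕ), x.Prime := by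
    intro x hx
    simp only [List.mem_cons, List.not_mem_nil, or_false] at hx
    rcases hx with rfl | rfl
    exacts [Nat.prime_two, hpr]
  have BPa := qrBit_eq_signBit_add_listSum (p := p) ha0 [2, q] (by simp [Ne.symm hq2]) hl2q (by simp [hp2, hpq])
    (fun r hr hrl hrp => (hev r hr (fun h => hrl (by simp [h])) hrp (fun h => hrl (by simp [h]))).1)
  have BPb := qrBit_eq_signBit_add_listSum (p := p) hb0 [2, q] (by simp [Ne.symm hq2]) hl2q (by simp [hp2, hpq])
    (fun r hr hrl hrp => (hev r hr (fun h => hrl (by simp [h])) hrp (fun h => hrl (by simp [h]))).2)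
  have BQa := qrBit_eq_signBit_add_listSum (p := q) ha0 [2, p] (by simp [Ne.symm hp2]) hl2p (by simp [hq2, hqp])
    (fun r hr hrl hrq => (hev r hr (fun h => hrl (by simp [h])) (fun h => hrl (by simp [h])) hrq).1)
  have BQb := qrBit_eq_signBit_add_listSum (p := q) hb0 [2, p] (by simp [Ne.symm hp2]) hl2p (by simp [hq2, hqp])
    (fun r hr hrl hrq => (hev r hr (fun h => hrl (by simp [h])) (fun h => hrl (by simp [h])) hrq).2)
  simp only [List.map_cons, List.map_nil, List.sum_cons, List.sum_nil] at BPa BPb BQa BQb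
  rw [hsa, cPm1, cP2, cPq] at BPa
  rw [cPm1, cP2, cPq] at BPb
  rw [hsa, cQm1, cQp] at BQa
  rw [cQm1, cQp] at BQb
  rw [BPa, BPb] at HP
  rw [BQa, BQb] at HQ
  rw [← hu] at HQ
  obtain ⟨HP1, HP2⟩ := HP
  obtain ⟨HQ1, HQ2⟩ := HQ
  simp only [mul_one, mul_zero, add_zero, zero_add] at HP1 HP2 HQ1 HQ2
  exact rows u _ _ _ _ _ _ _ HP1 HP2 HQ1 HQ2

/-- **The seven coordinates are injective on `Sel⁽²⁾(E_{2pq}/ℚ)`** (`p, q` odd, distinct): a Selmer class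
with representatives `a, b` of its components, all of whose coordinates `v₂ a, v_p a, v_q a, sign b, v₂ b, v_p b,
v_q b` vanish, has both components positive with all valuations even, i.e. trivial in `ℚˣ/ℚˣ²`, hence is
`0` by the injectivity of `(H¹(χ₁), H¹(χ₂))`. [cite: SilvermanAEC2009, Prop. X.1.4, Thm. X.1.1(c)] -/
theorem eq_zero_of_coords_eq_zero (hp2 : p ≠ 2) (hq2 : q ≠ 2) (hpq : p ≠ q)
    {c : galH1Torsion (congruentNumberCurve (2 * (p * q))) 2}
    (hc : c ∈ (congruentNumberCurve (2 * (p * q))).selmerGroup 2) (a b : ℚˣ)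
    (ha : kummerEquiv ℚ 2 ((congruentNumberCurve (2 * (p * q))).twoTorsionCharH1 hT c) =
      Additive.ofMul (QuotientGroup.mk a))
    (hb : kummerEquiv ℚ 2 ((congruentNumberCurve (2 * (p * q))).twoTorsionCharH1 hT.swap₁₂ c) =
      Additive.ofMul (QuotientGroup.mk b))
    (c0 : parityBit 2 (a : ℚ) = 0) (c1 : parityBit p (a : ℚ) = 0) (c2 : parityBit q (a : ℚ) = 0)
    (c3 : signBit (b : ℚ) = 0) (c4 : parityBit 2 (b : ℚ) = 0) (c5 : parityBit p (b : ℚ) = 0)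
    (c6 : parityBit q (b : ℚ) = 0) : c = 0 := by
  have ha0 : (a : ℚ) ≠ 0 := a.ne_zero
  have hb0 : (b : ℚ) ≠ 0 := b.ne_zero
  have hev : ∀ r : ℕ, r.Prime → r ≠ 2 → r ≠ p → r ≠ q →
      Even (padicValRat r (a : ℚ)) ∧ Even (padicValRat r (b : ℚ)) := fun r hr hr2 hrp hrq =>
    even_padicValRat_of_mem (p := p) (q := q) hT hp2 hq2 hpq hc a b ha hb hr hr2 hrp hrq
  have hapos : 0 < (a : ℚ) := pos_of_mem (p := p) (q := q) hT hc a ha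
  have hbpos : 0 < (b : ℚ) := (signBit_eq_zero_iff hb0).mp c3
  have hall : ∀ r : ℕ, r.Prime → Even (padicValRat r (a : ℚ)) ∧ Even (padicValRat r (b : ℚ)) := by
    intro r hr
    by_cases hr2 : r = 2
    · subst hr2; exact ⟨parityBit_eq_zero_iff.mp c0, parityBit_eq_zero_iff.mp c4⟩
    by_cases hrp : r = p
    · subst hrp; exact ⟨parityBit_eq_zero_iff.mp c1, parityBit_eq_zero_iff.mp c5⟩
    by_cases hrq : r = q
    · subst hrq; exact ⟨parityBit_eq_zero_iff.mp c2, parityBit_eq_zero_iff.mp c6⟩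
    exact hev r hr hr2 hrp hrq
  have hsa : sqClass (a : ℚ) = 1 := sqClass_eq_one_of_forall ha0 hapos fun r hr => (hall r hr).1
  have hsb : sqClass (b : ℚ) = 1 := sqClass_eq_one_of_forall hb0 hbpos fun r hr => (hall r hr).2
  rw [mk_eq_sqClass, hsa, ofMul_one] at ha
  rw [mk_eq_sqClass, hsb, ofMul_one] at hb
  exact (congruentNumberCurve (2 * (p * q))).eq_zero_of_twoTorsionCharH1_eq_zero hT c
    ((AddEquiv.map_eq_zero_iff _).mp ha) ((AddEquiv.map_eq_zero_iff _).mp hb)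

/-- **`#Sel⁽²⁾(E_{2pq}/ℚ) ≤ 8` for `p ≡ 5 (mod 8)`, `q ≡ 3 (mod 4)`, `(p/q) = −1`** by complete
`2`-descent: seven coordinates, injective on the Selmer group, four independent relations
(`8 = 2^{7−4}`). With the three rational `2`-torsion points and a point of infinite order
(Monsky / Tian) this is `#Sel₂(E_{2pq}) = 8`, `Ш(E_{2pq})[2] = 0`; only the upper bound is proved
here. [cite: SilvermanAEC2009, Prop. X.1.4, Prop. X.4.9] [cite: Monsky1990MockHeegner, Cor. 5.15 (2′) (p. 66)] -/
theorem card_selmerGroup_two_le_eight (h8p : p % 8 = 5) (h4q : q % 4 = 3) (hsym : jacobiSym p q = -1) :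
    Nat.card ((congruentNumberCurve (2 * (p * q))).selmerGroup 2) ≤ 8 := by
  have hp2 : p ≠ 2 := by rintro rfl; norm_num at h8p
  have hq2 : q ≠ 2 := by rintro rfl; norm_num at h4q
  have hpq : p ≠ q := by rintro rfl; omega
  haveI := isElliptic_congruentNumberCurve (two_mul_ne_zero (p := p) (q := q))
  have hT := splitTwoTorsion_cn (2 * (p * q))
  set W := congruentNumberCurve (2 * (p * q)) with hW
  obtain ⟨u, hu⟩ : ∃ u : ZMod 2, u = qrBit q ((2 : ℕ) : ℚ) := ⟨_, rfl⟩
  obtain ⟨κ, hκ⟩ : ∃ κ : (Fin 7 → ZMod 2) →+ (Fin 4 → ZMod 2),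
      κ = (Matrix.mulVecLin (!![1, 0, 1, 0, 0, 1, 0; 0, 0, 0, 0, 1, 0, 1; u, 1, 1 + u, 0, 0, 0, u;
        0, 0, 1, 1, u, 1, u] : Matrix (Fin 4) (Fin 7) (ZMod 2))).toAddMonoidHom := ⟨_, rfl⟩
  have hsurj : Function.Surjective κ := by rw [hκ]; exact κ_surjective u
  -- the two components and the seven coordinates, as additive maps on `H¹(ℚ, E[2])`
  obtain ⟨F₁, hF₁⟩ : ∃ F₁ : galH1Torsion W 2 →+ Additive (SqUnits ℚ),
      ∀ c, F₁ c = kummerEquiv ℚ 2 (W.twoTorsionCharH1 hT c) :=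
    ⟨(kummerEquiv ℚ 2).toAddMonoidHom.comp (W.twoTorsionCharH1 hT), fun c => rfl⟩
  obtain ⟨F₂, hF₂⟩ : ∃ F₂ : galH1Torsion W 2 →+ Additive (SqUnits ℚ),
      ∀ c, F₂ c = kummerEquiv ℚ 2 (W.twoTorsionCharH1 hT.swap₁₂ c) :=
    ⟨(kummerEquiv ℚ 2).toAddMonoidHom.comp (W.twoTorsionCharH1 hT.swap₁₂), fun c => rfl⟩
  obtain ⟨ψ, hψ⟩ : ∃ ψ : galH1Torsion W 2 →+ (Fin 7 → ZMod 2), ∀ c,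
      ψ c = ![parityHom 2 (F₁ c), parityHom p (F₁ c), parityHom q (F₁ c), signHom (F₂ c),
        parityHom 2 (F₂ c), parityHom p (F₂ c), parityHom q (F₂ c)] :=
    ⟨AddMonoidHom.pi fun i => (![(parityHom 2).comp F₁, (parityHom p).comp F₁, (parityHom q).comp F₁,
        signHom.comp F₂, (parityHom 2).comp F₂, (parityHom p).comp F₂, (parityHom q).comp F₂] :
          Fin 7 → (galH1Torsion W 2 →+ ZMod 2)) i,
      fun c => by ext i; fin_cases i <;> rfl⟩
  -- representatives and the value of `ψ` on them
  have hrep : ∀ c : galH1Torsion W 2, ∃ a b : ℚˣ,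
      kummerEquiv ℚ 2 (W.twoTorsionCharH1 hT c) = Additive.ofMul (QuotientGroup.mk a) ∧
      kummerEquiv ℚ 2 (W.twoTorsionCharH1 hT.swap₁₂ c) = Additive.ofMul (QuotientGroup.mk b) ∧
      ψ c = ![parityBit 2 (a : ℚ), parityBit p (a : ℚ), parityBit q (a : ℚ), signBit (b : ℚ),
        parityBit 2 (b : ℚ), parityBit p (b : ℚ), parityBit q (b : ℚ)] := by
    intro c
    obtain ⟨a, ha⟩ := QuotientGroup.mk_surjective (Additive.toMul (F₁ c))
    obtain ⟨b, hb⟩ := QuotientGroup.mk_surjective (Additive.toMul (F₂ c))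
    have ha' : F₁ c = Additive.ofMul (QuotientGroup.mk a) := by rw [ha, ofMul_toMul]
    have hb' : F₂ c = Additive.ofMul (QuotientGroup.mk b) := by rw [hb, ofMul_toMul]
    refine ⟨a, b, (hF₁ c).symm.trans ha', (hF₂ c).symm.trans hb', ?_⟩
    rw [hψ c, ha', hb', mk_eq_sqClass, mk_eq_sqClass, parityHom_sqClass a.ne_zero,
      parityHom_sqClass a.ne_zero, parityHom_sqClass a.ne_zero, signHom_sqClass b.ne_zero,
      parityHom_sqClass b.ne_zero, parityHom_sqClass b.ne_zero, parityHom_sqClass b.ne_zero]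
  -- `ψ` maps the Selmer group into `ker κ`, injectively
  have hkill : ∀ c : W.selmerGroup 2, ψ (c : galH1Torsion W 2) ∈ κ.ker := fun c => by
    obtain ⟨a, b, ha, hb, hψc⟩ := hrep c
    rw [AddMonoidHom.mem_ker, hψc, hκ]
    exact kill_selmer hT h8p h4q hsym c.2 a b ha hb u hu
  let f : W.selmerGroup 2 → κ.ker := fun c => ⟨ψ (c : galH1Torsion W 2), hkill c⟩
  have hf : Function.Injective f := by
    intro c₁ c₂ h12
    have h12' : ψ (c₁ : galH1Torsion W 2) = ψ (c₂ : galH1Torsion W 2) := congrArg Subtype.val h12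
    have hsub : ψ ((c₁ : galH1Torsion W 2) - c₂) = 0 := by rw [map_sub, h12', sub_self]
    obtain ⟨a, b, ha, hb, hψc⟩ := hrep ((c₁ : galH1Torsion W 2) - c₂)
    rw [hψc] at hsub
    have e0 := congr_fun hsub 0
    have e1 := congr_fun hsub 1
    have e2 := congr_fun hsub 2
    have e3 := congr_fun hsub 3
    have e4 := congr_fun hsub 4
    have e5 := congr_fun hsub 5
    have e6 := congr_fun hsub 6
    simp only [Matrix.cons_val_zero, Matrix.cons_val_one, Matrix.cons_val, Pi.zero_apply] at e0 e1 e2 e3 e4 e5 e6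
    have := eq_zero_of_coords_eq_zero hT hp2 hq2 hpq (sub_mem c₁.2 c₂.2) a b ha hb e0 e1 e2 e3 e4 e5 e6
    exact Subtype.ext (sub_eq_zero.mp this)
  have hcard : Nat.card (W.selmerGroup 2) ≤ Nat.card κ.ker := Nat.card_le_card_of_injective f hf
  have hker := natCard_ker_of_surjective κ hsurj
  have h8 : Nat.card κ.ker = 8 := by
    have h16 : (2 : ℕ) ^ 4 = 16 := by norm_num
    have h128 : (2 : ℕ) ^ 7 = 128 := by norm_num
    rw [h16, h128] at hker
    omega
  rw [h8] at hcard
  exact hcard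

end CongruentNumberTwicePrimePairSelmer

/-- **`#Sel⁽²⁾(E_{2pq}/ℚ) ≤ 8` for all primes `p ≡ 5 (mod 8)`, `q ≡ 3 (mod 4)` with `(p/q) = −1`**
(instance-free form; the binder `hSel` / `hD` of the cell `bsd-monsky`'s enclosure, `𝒮⁻` being this
half-family): by complete `2`-descent on Selmer classes. [cite: SilvermanAEC2009, Prop. X.1.4, Prop. X.4.9]
[cite: Monsky1990MockHeegner, Cor. 5.15 (2′) (p. 66)] -/
theorem card_selmerGroup_two_le_eight_congruentNumberCurve_two_mul_of_jacobiSym_eq_neg_one {p q : ℕ}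
    (hp : p.Prime) (hq : q.Prime) (h8p : p % 8 = 5) (h4q : q % 4 = 3) (hsym : jacobiSym p q = -1) :
    Nat.card ((congruentNumberCurve (2 * (p * q))).selmerGroup 2) ≤ 8 :=
  haveI : Fact p.Prime := ⟨hp⟩
  haveI : Fact q.Prime := ⟨hq⟩
  CongruentNumberTwicePrimePairSelmer.card_selmerGroup_two_le_eight h8p h4q hsym

end Literature.NumberTheory.EllipticCurves

end
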